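import Literature.MathematicalPhysics.QuantumFieldTheory.Balaban1983to89.B9B8KnitNeumannJunction

/-!
# `Balaban1983to89.B9B8KnitNeumannJunctionHerm` — the (B)-line bond junction, file 7c′: the Neumann junction of file 7c with the closeness
# `|Δ_a(U)a − (c_fη)²·(Δ_knit a♯)♭|₍₋₃₎ ≤ ε|a|₍₋₁₎` asked ONLY FOR HERMITIAN box fields `a` (the edition the sector suppliers can inhabit)

statement-level skeleton of published theorems with citation tags; proofs where landed; nothing here is a claim about the
Yang–Mills mass gap

Sub-row G-B8-T2S (unit `lit-balaban-t2s-1`, gen 7), lit-balaban RULING #10 road (d) — the Neumann junction of file 7c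
(`B9B8KnitNeumannJunction.gopZdHPer_three_members`, gen 6) displayed ONE closeness hypothesis
`hE : ∀ a, |Δ_a(U)a − (c_fη)²·(Δ_knit a♯)♭|₍₋₃₎ ≤ ε|a|₍₋₁₎` over ALL box bond functions `a : FBondY i → 𝔸`.  LOCATED (gen 7): that quantifier is too
strong for the intended suppliers — the knit's Landau letter `D·R^per(U₀)·D*` (dag-n06-w4's `projRPer`, the REAL-orthogonal projection onto the
Hermitian-valued range `Δ N_𝔤^per(Q′)` for the pairing `Re τ(f*g)`, [4] (3.20)–(3.22)) vanishes on `i·h` for Hermitian `h`, whereas def-Y's ℂ-linear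
`D_U R(U) D*_U` ((3.25)–(3.26)) does not; the two Landau letters agree (file 4, `B9B8KnitLandauProjection.projRPer_eq_liftL_RY`) on HERMITIAN periodic
data only — print's fields ARE Hermitian (`𝔤`-valued, [4] p. 391; [B8] (1.58) p. 86).  THIS FILE re-proves the junction with the closeness asked only
for pointwise-Hermitian `a` (`∀ b, IsSelfAdjoint (a b)`), which is all the proof ever reads: the periodic Hermitian carrier `E_𝔤^per(P₀)` descends to
Hermitian box fields.  DEVICE: the ℝ-linear Hermitian-part projection `π a := ½(a + a†)` on box fields (`|π a|₍α₎ ≤ |a|₍α₎`, `π a = a` for Hermitian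
`a`); the perturbation fed to the Neumann core of file 7b is `E′ := (Δ_a(U) − (c_fη)²·K)∘π` (small on ALL `a` from the Hermitian closeness), so that
`Δ_a(U) − E′ = (c_fη)²·K∘π + Δ_a(U)∘(1 − π)` agrees with `(c_fη)²·K` on Hermitian box fields — no reality hypothesis on def-Y's letters is needed.
Print: [4] Thm 3.3 p. 399, (3.47) p. 398, (3.26)–(3.27) p. 395, p. 391 («𝔤-valued»); [B8] (1.58)–(1.59) p. 86, p. 77 («Ω_j = T_η»).

WHAT IS PROVED (kernel, 0 sorry, theorems only).
* §1 `isSelfAdjoint_descBd` (the descent of a Hermitian-valued knit field is Hermitian), `norm_half_add_star_le` (`‖½(x + x†)‖ ≤ ‖x‖`).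
* §2 ★★★ `gopZdHPer_three_members_herm` — file 7c's `gopZdHPer_three_members` VERBATIM except that `hE` is asked only for Hermitian `a`; the
  Hermitian part `π` is a local `let` of the proof (no new definition).

HONEST SCOPE.  Assembly (files 1, 3, 7a–7c + dag-n06's periodic Green's-function API); the Hermitian closeness and def-Y's three members remain
DISPLAYED hypotheses (files 5–6 resp. p38's M5.7 supply them); no estimate of [4]∕[B8] is proved here; count-neutral; nothing continuum ∕ mass gap ∕
Clay — the Yang–Mills mass gap is NOT proved by any of this.  No `sorry`, no `def`, no `… : Prop` fact, no `instance`, no `notation`.  NEW file; file 7c is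
used BY NAME (`regularAtHPer_of_injective_box`, bookkeeping §1), nothing landed is modified.
-/

noncomputable section

namespace Literature.MathematicalPhysics.QuantumFieldTheory.Balaban1983to89.B9B8KnitNeumannJunctionHerm

open scoped BigOperators
open Node00
open B7Prop1Explicit renaming Site → LSite
open B7Prop1Explicit (e)
open B12Ineq417Flat (shiftCfg)
open B6KLevelCensusIndexV1 (KIdx)
open B6GlobalChartV1 (PV blkV1)
open B8ScaledSupNorm (weight msup bondNorm Bdd)
open B8Ineq132 (covDerivFwd)
open B8Eq138LandauZd (covLap)
open B8Ineq159AtLettersY (wNormBY_nonneg wNormBY_le_of_weight_mul_norm_le weight_mul_norm_le_wNormBY)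
open B9B8KnitBondTransfer (descBd liftBd descBd_apply liftBd_apply descBd_liftBd liftBd_descBd liftBd_periodic cdB_transl lapB_transl)
open B9B8KnitNormsTransfer (weight_level_pos norm_liftBd_le norm_liftBd_le_of_wNormBY_le wNormBY_descBd_le msup_le_weight_top_mul bdd_of_forall_norm_le
  weight_top_mul_norm_le_bondNorm_univ bondNorm_le_weight_top_mul weight_defY_eq_mul_weight_knit)
open B9B8KnitNeumannCore (wNormBY_eq_weight_mul_norm)
open B9B8KnitNeumannCoreReal (GAY_sub_three_members_real)
open B9B8KnitLandauProjection (apply_add_period_of_isPeriodic shiftCfg_eq_of_isPeriodic)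
open B9B8CarrierDictionary (liftCfg)
open B8Thm2TorusLettersPerOfKnit (bgY liftCfg_bgY)
open B9SupplySockB9P3ZdLetters (OpsZd deltaAOf)
open B9Eq327GreenZd (LinearOnDomAt)
open B9Eq327GreenZdHermPer (domSubHPer mem_domSubHPer_iff mem_domSub_univ finiteDimensional_domSubHPer RegularAtHPer PerPreservingAt gopZdHPer
  gopZdHPer_apply_eq_of_regularAtHPer)
open B9B8KnitNeumannJunction (descBd_add descBd_smul liftBd_zero wNormBY_real_smul norm_descBd_le_pi norm_apply_le_pi_descBd
  regularAtHPer_of_injective_box)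
open T4TermwiseTorus (IsPeriodic)

variable {d ℓ : ℕ} {hd : 1 ≤ d + 1} {hL : Odd (ℓ + 1) ∧ 1 < ℓ + 1} {b₀ b₁ : ℝ}
variable {𝔸 : Type} [CStarAlgebra 𝔸]
variable (i : KIdx d ℓ hd hL b₀ b₁) {n : ℕ}

/-! ## §1 Two bookkeeping lemmas -/

omit [CStarAlgebra 𝔸] in
/-- the descent of a Hermitian-valued knit bond field is a Hermitian box field. [cite: Balaban1985BackgroundPropagators, p.391, bookkeeping] -/
theorem isSelfAdjoint_descBd [Star 𝔸] {A : LSite (d + 1) → Fin (d + 1) → 𝔸} (hA : ∀ (y : LSite (d + 1)) (τ : Fin (d + 1)), IsSelfAdjoint (A y τ))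
    (b : FBondY i) : IsSelfAdjoint (descBd i A b) := by
  rw [descBd_apply]; exact hA _ _

/-- `‖½(x + x†)‖ ≤ ‖x‖` (the involution is isometric). [cite: Balaban1985BackgroundPropagators, p.391 («𝔤-valued»), bookkeeping] -/
theorem norm_half_add_star_le (x : 𝔸) : ‖(2⁻¹ : ℝ) • (x + star x)‖ ≤ ‖x‖ := by
  rw [← Complex.coe_smul, norm_smul]
  have h2 : ‖((2⁻¹ : ℝ) : ℂ)‖ = 2⁻¹ := by
    rw [Complex.norm_real, Real.norm_eq_abs, abs_of_pos (by norm_num)]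
  rw [h2]
  calc 2⁻¹ * ‖x + star x‖ ≤ 2⁻¹ * (‖x‖ + ‖star x‖) := mul_le_mul_of_nonneg_left (norm_add_le _ _) (by norm_num)
    _ = ‖x‖ := by rw [norm_star]; ring

/-! ## §2 The assembled junction with the Hermitian closeness -/

/-- ★★★ **THE NEUMANN JUNCTION, HERMITIAN EDITION.**  File 7c's `gopZdHPer_three_members` with the junction closeness asked ONLY for Hermitian box
fields: at a constant-level member with `c_f = L^{n+1}` and knit spacing `η > 0`, for a letter record `o` whose `Δ_knit = deltaAOf η o U₀` is real-linear
and preserves `E_𝔤^per(P₀)` at the periodic background `U₀`, for def-Y's `Δ_a(U) = deltaAY i parS parB Gp U`, `U = bgY i U₀`, invertible with the three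
(3.47)_{γ=−3} members at `B₀`, and under the HERMITIAN junction closeness `|Δ_a(U)a − (c_fη)²·(Δ_knit a♯)♭|₍₋₃₎ ≤ ε|a|₍₋₁₎` for every pointwise
Hermitian `a`, with `0 ≤ ε`, `2εB₀ ≤ 1` (OUR READING): `RegularAtHPer η o P₀ U₀`, and for every periodic Hermitian `J` the three global entries of
[4] Thm 3.3 ∕ [B8] (1.59) lines 1, 2, 4 hold for `G_𝔤^per J = gopZdHPer η o P₀ U₀ J` in the knit's currency with constant `2B₀`.
[cite: Balaban1985BackgroundPropagators, Thm 3.3 p.399, (3.47) p.398, (3.26)–(3.27) p.395, p.391; Balaban1985RegularSpaces, (1.58)–(1.59) p.86, p.77 («Ω_j = T_η»)] -/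
theorem gopZdHPer_three_members_herm [FiniteDimensional ℝ 𝔸] (hlev : ∀ z : SiteY i, levY i z = n)
    (hcf : i.cf = (((ℓ + 1 : ℕ) : ℝ)) ^ (n + 1)) {η : ℝ} (hη : 0 < η) {o : OpsZd (d + 1) 𝔸}
    {U₀ : LSite (d + 1) → Fin (d + 1) → 𝔸ˣ} (hU₀per : IsPeriodic ((PV d ℓ i.m i.K hd hL).sitesPerDir 0) U₀)
    (hlin : LinearOnDomAt η o (Set.univ : Set (LSite (d + 1))) U₀) (hpres : PerPreservingAt η o ((PV d ℓ i.m i.K hd hL).sitesPerDir 0) U₀)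
    (parS : SiteParY 𝔸 i) (parB : BondParY 𝔸 i) (Gp : SiteOpY 𝔸 i) (hΔ : IsUnit (deltaAY i parS parB Gp (bgY i U₀))) {B₀ ε : ℝ}
    (hB₀ : 0 ≤ B₀) (hε : 0 ≤ ε) (hεB : 2 * ε * B₀ ≤ 1)
    (hG0 : ∀ F, wNormBY i (-1) (GAY i parS parB Gp (bgY i U₀) F) ≤ B₀ * wNormBY i (-3) F)
    (hG1 : ∀ F ν, wNormBY i (-2) (cdB i (bgY i U₀) ν (GAY i parS parB Gp (bgY i U₀) F)) ≤ B₀ * wNormBY i (-3) F)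
    (hG3 : ∀ F, wNormBY i (-3) (lapB i (bgY i U₀) (GAY i parS parB Gp (bgY i U₀) F)) ≤ B₀ * wNormBY i (-3) F)
    (hE : ∀ a : FBondY i → 𝔸, (∀ b, IsSelfAdjoint (a b)) →
      wNormBY i (-3) (deltaAY i parS parB Gp (bgY i U₀) a - ((i.cf * η) ^ 2 : ℝ) • descBd i (deltaAOf η o U₀ (liftBd i a)))
        ≤ ε * wNormBY i (-1) a) :
    RegularAtHPer η o ((PV d ℓ i.m i.K hd hL).sitesPerDir 0) U₀ ∧
      ∀ J ∈ domSubHPer (d := d + 1) (𝔸 := 𝔸) ((PV d ℓ i.m i.K hd hL).sitesPerDir 0),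
        msup (ℓ + 1) n η (-(1 : ℝ)) (fun _ (_ : LSite (d + 1) × Fin (d + 1)) => True)
            (fun b => gopZdHPer η o ((PV d ℓ i.m i.K hd hL).sitesPerDir 0) U₀ J b.1 b.2) ≤
          2 * B₀ * bondNorm (ℓ + 1) n η (-(3 : ℝ)) (fun _ => (Set.univ : Set (LSite (d + 1)))) J ∧
        msup (ℓ + 1) n η (-(2 : ℝ)) (fun _ (_ : Fin (d + 1) × Fin (d + 1) × LSite (d + 1)) => True)
            (fun t => covDerivFwd η U₀ t.1 (fun z => gopZdHPer η o ((PV d ℓ i.m i.K hd hL).sitesPerDir 0) U₀ J z t.2.1) t.2.2) ≤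
          2 * B₀ * bondNorm (ℓ + 1) n η (-(3 : ℝ)) (fun _ => (Set.univ : Set (LSite (d + 1)))) J ∧
        bondNorm (ℓ + 1) n η (-(3 : ℝ)) (fun _ => (Set.univ : Set (LSite (d + 1))))
            (fun x μ => covLap η U₀ (fun z => gopZdHPer η o ((PV d ℓ i.m i.K hd hL).sitesPerDir 0) U₀ J z μ) x) ≤
          2 * B₀ * bondNorm (ℓ + 1) n η (-(3 : ℝ)) (fun _ => (Set.univ : Set (LSite (d + 1)))) J := by
  haveI : NeZero ((PV d ℓ i.m i.K hd hL).sitesPerDir 0) := ⟨(PV d ℓ i.m i.K hd hL).sitesPerDir_ne_zero 0⟩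
  set P₀ := (PV d ℓ i.m i.K hd hL).sitesPerDir 0 with hP₀
  set cr : ℝ := (i.cf * η) ^ 2 with hcr
  have hL1 : 1 ≤ ℓ + 1 := Nat.le_add_left 1 ℓ
  have hLpos : (0 : ℝ) < ((ℓ + 1 : ℕ) : ℝ) := by positivity
  have hcf0 : 0 < i.cf := by rw [hcf]; exact pow_pos hLpos _
  have hx : 0 < i.cf * η := mul_pos hcf0 hη
  have hcr0 : 0 < cr := pow_pos hx 2
  have hcrne : cr ≠ 0 := hcr0.ne'
  have hη0 : η ≠ 0 := hη.ne'
  have hU₀sh : ∀ μ : Fin (d + 1), shiftCfg (((P₀ : ℕ) : ℤ) • e μ) U₀ = U₀ := fun μ => shiftCfg_eq_of_isPeriodic hU₀per μ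
  -- the Hermitian part `π a = ½(a + a†)` of a box field, an ℝ-linear projection onto Hermitian box fields
  let π : Module.End ℝ (FBondY i → 𝔸) :=
    { toFun := fun a b => (2⁻¹ : ℝ) • (a b + star (a b))
      map_add' := fun a a' => by
        funext b
        simp only [Pi.add_apply, star_add, smul_add]
        abel
      map_smul' := fun r a => by
        funext b
        simp only [Pi.smul_apply, RingHom.id_apply, star_smul, star_trivial, ← smul_add, smul_comm r (2⁻¹ : ℝ)] }
  have hπapply : ∀ (a : FBondY i → 𝔸) (b : FBondY i), π a b = (2⁻¹ : ℝ) • (a b + star (a b)) := fun _ _ => rfl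
  have hπherm : ∀ a : FBondY i → 𝔸, (∀ b, IsSelfAdjoint (a b)) → π a = a := fun a ha => by
    funext b
    rw [hπapply, (ha b).star_eq, ← two_smul ℝ (a b), smul_smul, inv_mul_cancel₀ (two_ne_zero' ℝ), one_smul]
  have hπsa : ∀ (a : FBondY i → 𝔸) (b : FBondY i), IsSelfAdjoint (π a b) := fun a b => by
    rw [hπapply]
    exact (IsSelfAdjoint.all _).smul (IsSelfAdjoint.add_star_self (a b))
  have hπnorm : ∀ (α : ℝ) (a : FBondY i → 𝔸), wNormBY i α (π a) ≤ wNormBY i α a := fun α a =>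
    wNormBY_le_of_weight_mul_norm_le i (wNormBY_nonneg i α a) fun x =>
      (mul_le_mul_of_nonneg_left (by rw [hπapply]; exact norm_half_add_star_le (a x))
        (B8ScaledSupNorm.weight_nonneg (ℓ + 1) (inv_nonneg.2 (abs_nonneg _)) α _)).trans (weight_mul_norm_le_wNormBY i α a x)
  -- the real-linear box conjugate `K a = (Δ_knit a♯)♭`
  obtain ⟨T, hT⟩ := hlin
  let K : Module.End ℝ (FBondY i → 𝔸) :=
    { toFun := fun a => descBd i (T (liftBd i a))
      map_add' := fun a b => by
        have : liftBd i (a + b) = liftBd i a + liftBd i b := rfl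
        rw [this, map_add]; rfl
      map_smul' := fun r a => by
        have : liftBd i (r • a) = r • liftBd i a := rfl
        rw [this, map_smul]; rfl }
  have hKapply : ∀ a, K a = descBd i (deltaAOf η o U₀ (liftBd i a)) := fun a => by
    show descBd i (T (liftBd i a)) = _
    rw [hT _ (mem_domSub_univ _)]
  set TY : Module.End ℝ (FBondY i → 𝔸) := (deltaAY i parS parB Gp (bgY i U₀)).restrictScalars ℝ with hTY
  -- the perturbation through the Hermitian part: `E′ = (Δ_a(U) − c·K) ∘ π`
  set E : Module.End ℝ (FBondY i → 𝔸) := (TY - cr • K) ∘ₗ π with hEdef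
  have hEapply : ∀ a, E a = deltaAY i parS parB Gp (bgY i U₀) (π a) -
      cr • descBd i (deltaAOf η o U₀ (liftBd i (π a))) := fun a => by
    rw [hEdef, LinearMap.comp_apply, LinearMap.sub_apply, LinearMap.smul_apply, hKapply]
    rfl
  have hE' : ∀ a, wNormBY i (-3) (E a) ≤ ε * wNormBY i (-1) a := fun a => by
    rw [hEapply]
    exact (hE (π a) (hπsa a)).trans (mul_le_mul_of_nonneg_left (hπnorm (-1) a) hε)
  -- `Δ_a(U) − E′` agrees with `c·K` on Hermitian box fields
  have hsubH : ∀ a : FBondY i → 𝔸, (∀ b, IsSelfAdjoint (a b)) → (TY - E) a = cr • K a := fun a ha => by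
    rw [LinearMap.sub_apply, hEdef, LinearMap.comp_apply, hπherm a ha, LinearMap.sub_apply, LinearMap.smul_apply, sub_sub_cancel]
  -- the Neumann core (file 7b)
  obtain ⟨hU, h0, h1, h3⟩ :=
    GAY_sub_three_members_real i hlev parS parB Gp (bgY i U₀) hΔ hB₀ hε hεB hG0 hG1 hG3 E hE'
  change IsUnit (TY - E) at hU
  change ∀ F, wNormBY i (-1) (Ring.inverse (TY - E) F) ≤ 2 * B₀ * wNormBY i (-3) F at h0
  change ∀ F ν, wNormBY i (-2) (cdB i (bgY i U₀) ν (Ring.inverse (TY - E) F)) ≤ 2 * B₀ * wNormBY i (-3) F at h1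
  change ∀ F, wNormBY i (-3) (lapB i (bgY i U₀) (Ring.inverse (TY - E) F)) ≤ 2 * B₀ * wNormBY i (-3) F at h3
  have hinv : ∀ v, Ring.inverse (TY - E) ((TY - E) v) = v := fun v => by
    have h2 := congrArg (fun S : Module.End ℝ (FBondY i → 𝔸) => S v) (Ring.inverse_mul_cancel _ hU)
    simpa only [Module.End.mul_apply, Module.End.one_apply] using h2
  -- `RegularAtHPer` through the injective box map `K₀ = c⁻¹·(Δ_a(U) − E′)`, which is `K` on Hermitian box fields
  let K₀ : (FBondY i → 𝔸) → (FBondY i → 𝔸) := fun a => cr⁻¹ • (TY - E) a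
  have hK₀inj : ∀ a, K₀ a = 0 → a = 0 := fun a ha => by
    have h1' : (TY - E) a = 0 := by
      have h := ha
      simp only [K₀, smul_eq_zero, inv_eq_zero, hcrne, false_or] at h
      exact h
    have h2 := hinv a
    rw [h1', map_zero] at h2
    exact h2.symm
  have hreg : RegularAtHPer η o P₀ U₀ :=
    regularAtHPer_of_injective_box i ⟨T, hT⟩ hpres K₀
      (fun A hA => by
        have hAh : ∀ b, IsSelfAdjoint (descBd i A b) := isSelfAdjoint_descBd i ((mem_domSubHPer_iff _ _).1 hA).2
        show cr⁻¹ • (TY - E) (descBd i A) = _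
        rw [hsubH _ hAh, smul_smul, inv_mul_cancel₀ hcrne, one_smul, hKapply,
          liftBd_descBd i (fun x j => apply_add_period_of_isPeriodic ((mem_domSubHPer_iff _ _).1 hA).1 x j)])
      hK₀inj
  refine ⟨hreg, fun J hJ => ?_⟩
  -- the solution `A'` of `Δ_knit A' = J` in the carrier, and `A'♭ = (Δ_a(U) − E′)⁻¹(c·J♭)`
  obtain ⟨Φ, hΦ, hbij⟩ := hreg
  obtain ⟨A', hA'⟩ := hbij.2 ⟨J, hJ⟩
  have hA'per : IsPeriodic P₀ (A' : LSite (d + 1) → Fin (d + 1) → 𝔸) := ((mem_domSubHPer_iff _ _).1 A'.2).1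
  have hA'h : ∀ b, IsSelfAdjoint (descBd i (A' : LSite (d + 1) → Fin (d + 1) → 𝔸) b) :=
    isSelfAdjoint_descBd i ((mem_domSubHPer_iff _ _).1 A'.2).2
  have hA'sh : ∀ (x : LSite (d + 1)) (j : Fin (d + 1)),
      (A' : LSite (d + 1) → Fin (d + 1) → 𝔸) (x + ((P₀ : ℕ) : ℤ) • e j) = (A' : LSite (d + 1) → Fin (d + 1) → 𝔸) x :=
    fun x j => apply_add_period_of_isPeriodic hA'per x j
  have hJper : IsPeriodic P₀ J := ((mem_domSubHPer_iff _ _).1 hJ).1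
  have hΔA' : deltaAOf η o U₀ A' = J := by
    have h := congrArg Subtype.val hA'
    rw [hΦ A'] at h
    exact h
  have hG : gopZdHPer η o P₀ U₀ J = A' :=
    gopZdHPer_apply_eq_of_regularAtHPer η o P₀ U₀ ⟨Φ, hΦ, hbij⟩ A'.2 fun y τ => by rw [hΔA']
  have hsol : descBd i (A' : LSite (d + 1) → Fin (d + 1) → 𝔸) = Ring.inverse (TY - E) (cr • descBd i J) := by
    have hKA : (TY - E) (descBd i (A' : LSite (d + 1) → Fin (d + 1) → 𝔸)) = cr • descBd i J := by
      rw [hsubH _ hA'h, hKapply, liftBd_descBd i hA'sh, hΔA']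
    have h2 := hinv (descBd i (A' : LSite (d + 1) → Fin (d + 1) → 𝔸))
    rw [hKA] at h2
    exact h2.symm
  -- weights and units
  set w₁ := weight (ℓ + 1) |i.cf|⁻¹ (-1) n with hw₁
  set w₂ := weight (ℓ + 1) |i.cf|⁻¹ (-2) n with hw₂
  set w₃ := weight (ℓ + 1) |i.cf|⁻¹ (-3) n with hw₃
  set k₁ := weight (ℓ + 1) η (-1) n with hk₁
  set k₂ := weight (ℓ + 1) η (-2) n with hk₂
  set k₃ := weight (ℓ + 1) η (-3) n with hk₃
  have hw₁p : 0 < w₁ := weight_level_pos i _ n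
  have hw₂p : 0 < w₂ := weight_level_pos i _ n
  have hw₃p : 0 < w₃ := weight_level_pos i _ n
  have hk₁p : 0 < k₁ := B8ScaledSupNorm.weight_pos hL1 hη _ n
  have hk₂p : 0 < k₂ := B8ScaledSupNorm.weight_pos hL1 hη _ n
  have hk₃p : 0 < k₃ := B8ScaledSupNorm.weight_pos hL1 hη _ n
  have hxne : i.cf * η ≠ 0 := hx.ne'
  have hk₁ne : k₁ ≠ 0 := hk₁p.ne'
  have hk₂ne : k₂ ≠ 0 := hk₂p.ne'
  have hk₃ne : k₃ ≠ 0 := hk₃p.ne'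
  have hr₁ : (i.cf * η) ^ (-1 : ℝ) = (i.cf * η)⁻¹ := by
    rw [show (-1 : ℝ) = -((1 : ℕ) : ℝ) by norm_num, Real.rpow_neg hx.le, Real.rpow_natCast, pow_one]
  have hr₂ : (i.cf * η) ^ (-2 : ℝ) = ((i.cf * η) ^ 2)⁻¹ := by
    rw [show (-2 : ℝ) = -((2 : ℕ) : ℝ) by norm_num, Real.rpow_neg hx.le, Real.rpow_natCast]
  have hr₃ : (i.cf * η) ^ (-3 : ℝ) = ((i.cf * η) ^ 3)⁻¹ := by
    rw [show (-3 : ℝ) = -((3 : ℕ) : ℝ) by norm_num, Real.rpow_neg hx.le, Real.rpow_natCast]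
  have hu₁ : w₁ = (i.cf * η)⁻¹ * k₁ := by rw [hw₁, weight_defY_eq_mul_weight_knit i hcf hη, hr₁]
  have hu₂ : w₂ = ((i.cf * η) ^ 2)⁻¹ * k₂ := by rw [hw₂, weight_defY_eq_mul_weight_knit i hcf hη, hr₂]
  have hu₃ : w₃ = ((i.cf * η) ^ 3)⁻¹ * k₃ := by rw [hw₃, weight_defY_eq_mul_weight_knit i hcf hη, hr₃]
  -- the source in def-Y currency: `|c·J♭|₍₋₃₎ ≤ c·w₃·‖J♭‖` and `k₃‖J♭‖ ≤ |J|₍₋₃₎`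
  set NJ := bondNorm (ℓ + 1) n η (-(3 : ℝ)) (fun _ => (Set.univ : Set (LSite (d + 1)))) J with hNJ
  have hJbd : ∀ (z : LSite (d + 1)) (κ : Fin (d + 1)), ‖J z κ‖ ≤ ‖descBd i J‖ := fun z κ => norm_apply_le_pi_descBd i hJper z κ
  have hNJ0 : 0 ≤ NJ := B8ScaledSupNorm.msup_nonneg (ℓ + 1) n hη.le _ _ _
  have hJsup : k₃ * ‖descBd i J‖ ≤ NJ := by
    rw [mul_comm, ← le_div_iff₀ hk₃p]
    refine (pi_norm_le_iff_of_nonneg (div_nonneg hNJ0 hk₃p.le)).2 fun b => ?_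
    rw [le_div_iff₀ hk₃p, mul_comm, descBd_apply]
    exact weight_top_mul_norm_le_bondNorm_univ hL1 hη (by norm_num) rfl hJbd _ _
  have hsrc : wNormBY i (-3) (cr • descBd i J) ≤ cr * (w₃ * ‖descBd i J‖) := by
    rw [wNormBY_real_smul i hlev, abs_of_pos hcr0]
    exact mul_le_mul_of_nonneg_left (wNormBY_descBd_le i hlev (norm_nonneg _) hJbd) hcr0.le
  refine ⟨?_, ?_, ?_⟩
  · -- n = 0 : `|GJ|₍₋₁₎ ≤ 2B₀|J|₍₋₃₎`
    have hpt : ∀ b : LSite (d + 1) × Fin (d + 1), ‖gopZdHPer η o P₀ U₀ J b.1 b.2‖ ≤ w₁⁻¹ * (2 * B₀ * (cr * (w₃ * ‖descBd i J‖))) := by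
      intro b
      rw [hG]
      have h := (h0 (cr • descBd i J)).trans (mul_le_mul_of_nonneg_left hsrc (by positivity))
      rw [← hsol] at h
      have h' := norm_liftBd_le_of_wNormBY_le i hlev h b.1 b.2
      rwa [liftBd_descBd i hA'sh] at h'
    refine (msup_le_weight_top_mul hL1 hη (by norm_num) (by positivity) hpt).trans ?_
    have hk : weight (ℓ + 1) η (-(1 : ℝ)) n = k₁ := rfl
    have : weight (ℓ + 1) η (-(1 : ℝ)) n * (w₁⁻¹ * (2 * B₀ * (cr * (w₃ * ‖descBd i J‖)))) = 2 * B₀ * (k₃ * ‖descBd i J‖) := by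
      rw [hk, hu₁, hu₃, hcr]; field_simp
    rw [this]
    exact mul_le_mul_of_nonneg_left hJsup (by positivity)
  · -- n = 1 : `|∇_{U₀}GJ|₍₋₂₎ ≤ 2B₀|J|₍₋₃₎`
    have hpt : ∀ t : Fin (d + 1) × Fin (d + 1) × LSite (d + 1),
        ‖covDerivFwd η U₀ t.1 (fun z => gopZdHPer η o P₀ U₀ J z t.2.1) t.2.2‖ ≤ (i.cf * η)⁻¹ * (w₂⁻¹ * (2 * B₀ * (cr * (w₃ * ‖descBd i J‖)))) := by
      intro t
      rw [hG]
      have h := (h1 (cr • descBd i J) t.1).trans (mul_le_mul_of_nonneg_left hsrc (by positivity))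
      rw [← hsol] at h
      have h' := B9B8KnitNormsTransfer.norm_covDerivFwd_le_of_wNormBY i η hlev hη0 hU₀sh hA'sh t.1 h t.2.2 t.2.1
      rw [norm_smul, Complex.norm_real, Real.norm_eq_abs, abs_of_pos hx] at h'
      rw [← div_eq_inv_mul, le_div_iff₀' hx]
      exact h'
    refine (msup_le_weight_top_mul hL1 hη (by norm_num) (by positivity) hpt).trans ?_
    have hk : weight (ℓ + 1) η (-(2 : ℝ)) n = k₂ := rfl
    have : weight (ℓ + 1) η (-(2 : ℝ)) n * ((i.cf * η)⁻¹ * (w₂⁻¹ * (2 * B₀ * (cr * (w₃ * ‖descBd i J‖))))) =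
        2 * B₀ * (k₃ * ‖descBd i J‖) := by
      rw [hk, hu₂, hu₃, hcr]; field_simp
    rw [this]
    exact mul_le_mul_of_nonneg_left hJsup (by positivity)
  · -- n = 3 : `|Δ_{U₀}GJ|₍₋₃₎ ≤ 2B₀|J|₍₋₃₎`
    have hpt : ∀ (x : LSite (d + 1)) (μ : Fin (d + 1)),
        ‖covLap η U₀ (fun z => gopZdHPer η o P₀ U₀ J z μ) x‖ ≤ ((i.cf * η) ^ 2)⁻¹ * (w₃⁻¹ * (2 * B₀ * (cr * (w₃ * ‖descBd i J‖)))) := by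
      intro x μ
      rw [hG]
      have h := (h3 (cr • descBd i J)).trans (mul_le_mul_of_nonneg_left hsrc (by positivity))
      rw [← hsol] at h
      have h' := B9B8KnitNormsTransfer.norm_covLap_le_of_wNormBY i η hlev hη0 hU₀sh hA'sh h x μ
      rw [norm_smul, norm_pow, Complex.norm_real, Real.norm_eq_abs, abs_of_pos hx] at h'
      rw [← div_eq_inv_mul, le_div_iff₀' (pow_pos hx 2)]
      exact h'
    refine (bondNorm_le_weight_top_mul hL1 hη (by norm_num) (by positivity) hpt).trans ?_
    have hk : weight (ℓ + 1) η (-(3 : ℝ)) n = k₃ := rfl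
    have hw₃ne : w₃ ≠ 0 := hw₃p.ne'
    have : weight (ℓ + 1) η (-(3 : ℝ)) n * (((i.cf * η) ^ 2)⁻¹ * (w₃⁻¹ * (2 * B₀ * (cr * (w₃ * ‖descBd i J‖))))) =
        2 * B₀ * (k₃ * ‖descBd i J‖) := by
      rw [hk, hcr]; field_simp
    rw [this]
    exact mul_le_mul_of_nonneg_left hJsup (by positivity)

end Literature.MathematicalPhysics.QuantumFieldTheory.Balaban1983to89.B9B8KnitNeumannJunctionHerm
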